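import Summits.BirchSwinnertonDyer.BirchSwinnertonDyer.Theorems.PrintCf2SplitBadTwoLineDoubleCosetPlaces
import Summits.BirchSwinnertonDyer.BirchSwinnertonDyer.Theorems.EisensteinPrimesAnomalousUnramifiedKernelFinite
import Literature.NumberTheory.EllipticCurves.IwasawaCoinvariantsRankProofs
import Literature.NumberTheory.EllipticCurves.SubgroupSelmerCocycleCriteriaProofs
import Literature.GroupTheory.Abelian.DescendingChainCondition
import Mathlib.RingTheory.Artinian.Module
import HarnessLib

/-!
# M-LINE-PIN, (C2b-tors) part 5: the LOCAL RECEPTACLE of the `v̄`-defect — `ker (H¹(A, M) → H¹(A ⊓ ker χ, M))` embeds additively into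
# `M^{A ⊓ ker χ} ⧸ (c − 1)` for a closed `A ≤ Γ_K` and a `ℤ_p`-character `χ` (`c ∈ A` of least `χ`-valuation), hence is ARTINIAN when `M` is

Cell `bsd-print-cf2`, width seat `bsd-line-cf2c-w2` g4 (prover-bsd-line-cf2c-w2-g4-0), planner g19's named piece M-LINE-PIN for the DECIDING
crux child `MainConjClauseAtSplitTwoQuad` (stmt-BirchSwinnertonDyer-24086); towards the DEFECT EMBEDDING (the cokernel of slot-1 control has finite
`p`-torsion type, the input `(Ob, hOb, hN)` of part 2's `LinePinDefect.isTorsion₂_of_slotOne_control`): the components of the defect live in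
`ker (H¹(ker κ ⊓ I_𝔮, M) → H¹(pairKer κ κ₂ ⊓ I_𝔮, M))`, and THIS file bounds that kernel. `--supports stmt-BirchSwinnertonDyer-24086 --as helper`,
Theses-free. HONEST FRAMING: generic group cohomology (Greenberg's Lemma 3.1 injection `ker res ↪ M^N ⧸ (γ − 1) M^N`, the tree's
`ResKernel.finite_subgroupResKer`, re-run for the tree's `resOfLe` between two subgroups `B ≤ A` of an ambient group and exported as an ADDITIVE
INJECTION rather than a cardinality bound) plus the `ℤ_p`-saturation bookkeeping making `A ⊓ ker χ` and one element generate `A`; no summit statement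
is proved by this seat; BSD is not proved by any of this. THEOREMS ONLY (no definition, no named fact, no `sorry`).

* §1 (any topological group `G`, discrete `G`-module `M` with continuous orbit maps, subgroups `B ≤ A`, `c ∈ A`):
  `exists_cocycle_of_resOfLe_eq_zero` (a class killed by `res^A_B` has a representative vanishing on `B`),
  `exists_fixedPoints_of_oneCocycleClass_eq` (two such representatives of one class differ by `∂b`, `b ∈ M^B`),
  **`exists_injective_addMonoidHom_ker_resOfLe`** — if every open subgroup of `A` containing `B` and `c` is `A`:
  `ker (res : H¹(A, M) → H¹(B, M)) ↪ M^{B} ⧸ (c − 1) M^{B}` additively (`[φ] ↦ φ(c)` on representatives vanishing on `B`);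
  **`isArtinian_ker_resOfLe`** — hence the kernel is an Artinian `ℤ`-module when `M` is.
* §2 (`G = Γ_K`, `χ : Γ_K → ℤ_p` a `ℤ_p`-extension, `A` closed, `B = A ⊓ ker χ`): `eq_top_of_isOpen_of_minimal_valuation` (an element `c ∈ A` of least
  `χ`-valuation generates `A` together with `A ⊓ ker χ`: `ℤ_p`-saturation `AnomalousLocalTorsion.exists_mem_apply_toAdd_eq_of_dvd`),
  `exists_generator_inf_kerSubgroup`, **`isArtinian_ker_resOfLe_inf_kerSubgroup`** — `ker (H¹(A, M) → H¹(A ⊓ ker χ, M))` is Artinian for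
  every closed `A` and Artinian `M`; `isArtinian_ker_resOfLe_inertia_pairKer` — the case `A = ker κ ⊓ I_𝔮`, `B = pairKer κ κ₂ ⊓ I_𝔮` of M-LINE-PIN.
presearch: Greenberg LNM 1716 §3 Lemma 3.1 (p. 86) «ker h_n ↪ B/(γ−1)B» — tree `ResKernel.finite_subgroupResKer` [corpus: GreenbergLNM1716 p. 86];
Kaplansky 1954 §9 Ex. 21 (dcc) — tree `Purity.isArtinian_*`; assembly, no new fact. beyond-print theorem: no.

References: [GreenbergLNM1716] §3 Lemma 3.1 p. 86; [SerreGaloisCohomology1997] I §2.6, I §5.1; [Washington1997] §13.1; [Kaplansky1954] §9 Ex. 21.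
-/

noncomputable section

open scoped Classical

-- the summit namespace `Summit.BirchSwinnertonDyer.BirchSwinnertonDyer` repeats the problem name by design (D-0017)
set_option linter.dupNamespace false
set_option autoImplicit false

open NumberField IsDedekindDomain Field
open Literature.NumberTheory.EllipticCurves Literature.NumberTheory.EllipticCurves.GreenbergSelmer
  Literature.NumberTheory.GaloisRepresentations
  Summit.BirchSwinnertonDyer.BirchSwinnertonDyer.Theorems.PrintCf2

namespace Summit.BirchSwinnertonDyer.BirchSwinnertonDyer.Theorems.PrintCf2.LinePinDefect

/-! ## §1. Greenberg's Lemma 3.1 injection for `resOfLe` -/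

section Generic

variable {G : Type} [Group G] [TopologicalSpace G] [IsTopologicalGroup G]
  {M : Type} [AddCommGroup M] [DistribMulAction G M] [TopologicalSpace M] [DiscreteTopology M]
  {A B : Subgroup G}

/-- A class of `H¹(A, M)` killed by restriction to `B ≤ A` is represented by a cocycle VANISHING on `B` (subtract the coboundary of the element
trivialising it on `B`). [cite: SerreGaloisCohomology1997, I §2.6] -/
theorem exists_cocycle_of_resOfLe_eq_zero (hBA : B ≤ A) (hcont : ∀ m : M, Continuous fun g : G ↦ g • m)
    (x : subgroupH1 A M) (hx : resOfLe M hBA x = 0) :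
    ∃ φ : contOneCocycles (discreteTopRep A M), oneCocycleClass _ φ = x ∧ ∀ n : A, (n : G) ∈ B → φ.1 n = 0 := by
  obtain ⟨φ, rfl⟩ := oneCocycleClass_surjective _ x
  obtain ⟨a, ha⟩ := (CocycleCriteria.resOfLe_oneCocycleClass_eq_zero_iff hBA φ).mp hx
  have hca : Continuous fun g : A ↦ g • a := (hcont a).comp continuous_subtype_val
  refine ⟨φ - cobCocycle a hca, ?_, fun n hn ↦ ?_⟩
  · rw [oneCocycleClass_sub, oneCocycleClass_cobCocycle, sub_zero]
  · have h := ha ⟨n, hn⟩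
    rw [Submodule.coe_sub, ContinuousMap.sub_apply, cobCocycle_apply, sub_eq_zero]
    exact h

/-- Two cocycles on `A` vanishing on `B` with the SAME class differ by the coboundary of a `B`-FIXED element: `φ − ψ = ∂b` with `b ∈ M^{B}`
(`∂b` vanishes on `B` iff `B` fixes `b`). [cite: SerreGaloisCohomology1997, I §2.6] [cite: GreenbergLNM1716, §3 Lemma 3.1] -/
theorem exists_fixedPoints_of_oneCocycleClass_eq (φ ψ : contOneCocycles (discreteTopRep A M))
    (hφ : ∀ n : A, (n : G) ∈ B → φ.1 n = 0) (hψ : ∀ n : A, (n : G) ∈ B → ψ.1 n = 0)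
    (h : oneCocycleClass _ φ = oneCocycleClass _ ψ) :
    ∃ b ∈ FixedPoints.addSubgroup (B.subgroupOf A) M, ∀ g : A, φ.1 g - ψ.1 g = g • b - b := by
  rw [← sub_eq_zero, ← oneCocycleClass_sub, oneCocycleClass_eq_zero_iff] at h
  obtain ⟨b, hb⟩ := h
  refine ⟨b, fun n ↦ ?_, fun g ↦ ?_⟩
  · have h1 := hb (n : A)
    rw [Submodule.coe_sub, ContinuousMap.sub_apply, hφ _ (Subgroup.mem_subgroupOf.mp n.2),
      hψ _ (Subgroup.mem_subgroupOf.mp n.2), sub_zero] at h1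
    exact (sub_eq_zero.mp h1.symm)
  · have h1 := hb g
    rwa [Submodule.coe_sub, ContinuousMap.sub_apply] at h1

/-- **GREENBERG'S LEMMA 3.1 INJECTION, additive form.** For subgroups `B ≤ A` of a topological group with `B` normal in `A`, an element
`c ∈ A` such that every open subgroup of `A` containing `B` and `c` is all of `A`, and a discrete `M` with continuous orbit maps: there is an
INJECTIVE additive map `ker (res : H¹(A, M) → H¹(B, M)) ↪ M^{B} ⧸ (c − 1) M^{B}`, `[φ] ↦ φ(c)` for a representative `φ` vanishing on `B`
(well defined and additive by `exists_fixedPoints_of_oneCocycleClass_eq`, injective by `ResKernel.oneCocycleClass_eq_of_sub_eq`).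
This is the inflation–restriction identification `ker res = H¹(A/B, M^B)` followed by `H¹(⟨c̄⟩, M^B) ↪ M^B/(c − 1)`.
[cite: GreenbergLNM1716, §3 Lemma 3.1 (p. 86)] [cite: SerreGaloisCohomology1997, I §2.6, XIII §1] -/
theorem exists_injective_addMonoidHom_ker_resOfLe (hBA : B ≤ A) [(B.subgroupOf A).Normal] {c : G} (hc : c ∈ A)
    (hgen : ∀ U : Subgroup A, IsOpen (U : Set A) → B.subgroupOf A ≤ U → (⟨c, hc⟩ : A) ∈ U → U = ⊤)
    (hcont : ∀ m : M, Continuous fun g : G ↦ g • m) :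
    ∃ w : (resOfLe M hBA).ker →+
        FixedPoints.addSubgroup (B.subgroupOf A) M ⧸ (ResKernel.subOne (B.subgroupOf A) M (⟨c, hc⟩ : A)).range,
      Function.Injective w := by
  have hcontA : ∀ m : M, Continuous fun g : A ↦ g • m := fun m ↦ (hcont m).comp continuous_subtype_val
  choose φ hφ hφB using fun x : (resOfLe M hBA).ker ↦ exists_cocycle_of_resOfLe_eq_zero hBA hcont x.1 x.2
  have hφN : ∀ x, ∀ n ∈ B.subgroupOf A, (φ x).1 n = 0 := fun x n hn ↦ hφB x n (Subgroup.mem_subgroupOf.mp hn)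
  -- the value at `c` of the chosen representative
  let v : (resOfLe M hBA).ker → FixedPoints.addSubgroup (B.subgroupOf A) M := fun x ↦
    ⟨(φ x).1 ⟨c, hc⟩, ResKernel.apply_mem_fixedPoints (B.subgroupOf A) M (φ x) (hφN x) ⟨c, hc⟩⟩
  -- independence of the representative
  have hwd : ∀ (x : (resOfLe M hBA).ker) (ψ : contOneCocycles (discreteTopRep A M)),
      (∀ n : A, (n : G) ∈ B → ψ.1 n = 0) → oneCocycleClass _ ψ = x.1 →
      ∀ hψc : ψ.1 ⟨c, hc⟩ ∈ FixedPoints.addSubgroup (B.subgroupOf A) M,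
        (QuotientAddGroup.mk ⟨ψ.1 ⟨c, hc⟩, hψc⟩ :
            FixedPoints.addSubgroup (B.subgroupOf A) M ⧸ (ResKernel.subOne (B.subgroupOf A) M (⟨c, hc⟩ : A)).range) =
          QuotientAddGroup.mk (v x) := by
    intro x ψ hψ hψx hψc
    obtain ⟨b, hb, hdiff⟩ := exists_fixedPoints_of_oneCocycleClass_eq ψ (φ x) hψ (hφB x) (hψx.trans (hφ x).symm)
    rw [QuotientAddGroup.eq_iff_sub_mem]
    exact ⟨⟨b, hb⟩, Subtype.ext (by
      simp only [ResKernel.coe_subOne_apply, AddSubgroup.coe_sub]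
      exact (hdiff ⟨c, hc⟩).symm)⟩
  refine ⟨AddMonoidHom.mk' (fun x ↦ (QuotientAddGroup.mk (v x) :
      FixedPoints.addSubgroup (B.subgroupOf A) M ⧸ (ResKernel.subOne (B.subgroupOf A) M (⟨c, hc⟩ : A)).range)) fun x y ↦ ?_, ?_⟩
  · -- additivity: `φ x + φ y` represents `x + y` and vanishes on `B`
    have hψB : ∀ n : A, (n : G) ∈ B → (φ x + φ y).1 n = 0 := fun n hn ↦ by
      rw [Submodule.coe_add, ContinuousMap.add_apply, hφB x n hn, hφB y n hn, add_zero]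
    have hcl : oneCocycleClass _ (φ x + φ y) = (x + y).1 := by
      rw [oneCocycleClass_add, hφ, hφ]; rfl
    have hmem : (φ x + φ y).1 ⟨c, hc⟩ ∈ FixedPoints.addSubgroup (B.subgroupOf A) M :=
      ResKernel.apply_mem_fixedPoints (B.subgroupOf A) M (φ x + φ y) (fun n hn ↦ hψB n (Subgroup.mem_subgroupOf.mp hn)) ⟨c, hc⟩
    have h := hwd (x + y) (φ x + φ y) hψB hcl hmem
    rw [← h, ← QuotientAddGroup.mk_add]
    exact congrArg _ (Subtype.ext rfl)
  · intro x y hxy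
    change (QuotientAddGroup.mk (v x) : FixedPoints.addSubgroup (B.subgroupOf A) M ⧸ _) = QuotientAddGroup.mk (v y) at hxy
    obtain ⟨b, hb⟩ := QuotientAddGroup.eq_iff_sub_mem.mp hxy
    have hval := congrArg (fun z : FixedPoints.addSubgroup (B.subgroupOf A) M ↦ (z : M)) hb
    simp only [ResKernel.coe_subOne_apply, AddSubgroup.coe_sub] at hval
    apply Subtype.ext
    rw [← hφ x, ← hφ y]
    exact ResKernel.oneCocycleClass_eq_of_sub_eq (B.subgroupOf A) M ⟨c, hc⟩ hgen hcontA (φ x) (φ y) (hφN x) (hφN y)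
      b.2 hval.symm

/-- **Hence `ker (H¹(A, M) → H¹(B, M))` is an ARTINIAN `ℤ`-module whenever `M` is** (it embeds into the subquotient `M^{B} ⧸ (c − 1) M^{B}` of `M`).
[cite: GreenbergLNM1716, §3 Lemma 3.1 (p. 86)] [cite: Kaplansky1954, §9 Exercise 21 (PDF p. 24)] -/
theorem isArtinian_ker_resOfLe (hBA : B ≤ A) [(B.subgroupOf A).Normal] {c : G} (hc : c ∈ A)
    (hgen : ∀ U : Subgroup A, IsOpen (U : Set A) → B.subgroupOf A ≤ U → (⟨c, hc⟩ : A) ∈ U → U = ⊤)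
    (hcont : ∀ m : M, Continuous fun g : G ↦ g • m) [IsArtinian ℤ M] :
    IsArtinian ℤ (resOfLe M hBA).ker := by
  obtain ⟨w, hw⟩ := exists_injective_addMonoidHom_ker_resOfLe hBA hc hgen hcont
  haveI : IsArtinian ℤ (FixedPoints.addSubgroup (B.subgroupOf A) M) :=
    Literature.GroupTheory.Abelian.Purity.isArtinian_addSubgroup _
  haveI : IsArtinian ℤ (FixedPoints.addSubgroup (B.subgroupOf A) M ⧸ (ResKernel.subOne (B.subgroupOf A) M (⟨c, hc⟩ : A)).range) :=
    isArtinian_of_surjective _ (QuotientAddGroup.mk' _).toIntLinearMap fun b ↦ by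
      obtain ⟨a, rfl⟩ := QuotientAddGroup.mk_surjective b
      exact ⟨a, rfl⟩
  exact isArtinian_of_injective w.toIntLinearMap hw

end Generic

/-! ## §2. `A ⊓ ker χ` and an element of least `χ`-valuation generate a closed `A ≤ Γ_K` -/

section Galois

variable {K : Type} [Field K] [NumberField K] {p : ℕ} [Fact p.Prime] (χ : ZpExtension K p)
  {M : Type} [AddCommGroup M] [DistribMulAction (absoluteGaloisGroup K) M] [TopologicalSpace M] [DiscreteTopology M]

/-- **`ℤ_p`-saturation: `A ⊓ ker χ` and an element `c ∈ A` of LEAST `χ`-valuation generate the closed subgroup `A` topologically.** An open subgroup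
`U ≤ A` containing `A ⊓ ker χ` (given as any `B` with `g ∈ B ↔ g ∈ A ∧ χ g = 1`) and `c` is `A`: its image in `Γ_K` is closed and contains `c`, so `χ(U) ⊇ p^{v(χ c)} ℤ_p ⊇ χ(A)`
(`AnomalousLocalTorsion.exists_mem_apply_toAdd_eq_of_dvd`, minimality), and `g = u · (u⁻¹ g)` with `u ∈ U`, `χ u = χ g`, `u⁻¹ g ∈ A ⊓ ker χ ⊆ U`.
[cite: Washington1997, §13.1] -/
theorem eq_top_of_isOpen_of_minimal_valuation (A B : Subgroup (absoluteGaloisGroup K)) (hA : IsClosed (A : Set (absoluteGaloisGroup K)))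
    (hB : ∀ g, g ∈ B ↔ g ∈ A ∧ χ g = 1) {c : absoluteGaloisGroup K} (hc : c ∈ A) (hne : χ c ≠ 1)
    (hmin : ∀ g ∈ A, (p : ℤ_[p]) ^ ((χ c).toAdd).valuation ∣ (χ g).toAdd)
    (U : Subgroup A) (hU : IsOpen (U : Set A)) (hN : B.subgroupOf A ≤ U) (hcU : (⟨c, hc⟩ : A) ∈ U) : U = ⊤ := by
  haveI : CompactSpace A := isCompact_iff_compactSpace.mp hA.isCompact
  have hUc : IsClosed ((U.map A.subtype : Subgroup (absoluteGaloisGroup K)) : Set (absoluteGaloisGroup K)) := by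
    have h1 : IsCompact (U : Set A) := (Subgroup.isClosed_of_isOpen U hU).isCompact
    rw [Subgroup.coe_map]
    exact (h1.image continuous_subtype_val).isClosed
  have hcU' : c ∈ U.map A.subtype := ⟨⟨c, hc⟩, hcU, rfl⟩
  rw [eq_top_iff]
  rintro ⟨g, hg⟩ -
  obtain ⟨τ, hτU, hτ⟩ := AnomalousLocalTorsion.exists_mem_apply_toAdd_eq_of_dvd χ (U.map A.subtype) hUc hcU' hne (hmin g hg)
  obtain ⟨u, huU, rfl⟩ := hτU
  have hker : u⁻¹ * (⟨g, hg⟩ : A) ∈ B.subgroupOf A := by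
    rw [Subgroup.mem_subgroupOf, hB]
    refine ⟨A.mul_mem (A.inv_mem u.2) hg, ?_⟩
    rw [Subgroup.coe_mul, Subgroup.coe_inv, map_mul, map_inv]
    apply Multiplicative.toAdd.injective
    rw [toAdd_mul, toAdd_inv, toAdd_one]
    change -(χ (u : absoluteGaloisGroup K)).toAdd + (χ g).toAdd = 0
    rw [show (χ (u : absoluteGaloisGroup K)).toAdd = (χ g).toAdd from hτ, neg_add_cancel]
  rw [← mul_inv_cancel_left u (⟨g, hg⟩ : A)]
  exact U.mul_mem huU (hN hker)

/-- **For every closed `A ≤ Γ_K` some `c ∈ A` generates `A` together with `A ⊓ ker χ`** (an element of least `χ`-valuation when `χ(A) ≠ 1`,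
`LineDoubleCoset.exists_mem_minimal_valuation`; anything when `A ⊆ ker χ`). [cite: Washington1997, §13.1] -/
theorem exists_generator_inf_kerSubgroup (A B : Subgroup (absoluteGaloisGroup K)) (hA : IsClosed (A : Set (absoluteGaloisGroup K)))
    (hB : ∀ g, g ∈ B ↔ g ∈ A ∧ χ g = 1) :
    ∃ c : A, ∀ U : Subgroup A, IsOpen (U : Set A) → B.subgroupOf A ≤ U → c ∈ U → U = ⊤ := by
  by_cases h : ∃ τ ∈ A, χ τ ≠ 1
  · obtain ⟨τ₀, hτ₀, hne₀⟩ := h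
    obtain ⟨c, hc, hne, hmin⟩ := LineDoubleCoset.exists_mem_minimal_valuation χ A hτ₀ hne₀
    exact ⟨⟨c, hc⟩, fun U hU hN hcU ↦ eq_top_of_isOpen_of_minimal_valuation χ A B hA hB hc hne hmin U hU hN hcU⟩
  · push Not at h
    refine ⟨1, fun U _ hN _ ↦ ?_⟩
    rw [eq_top_iff]
    rintro g -
    exact hN (Subgroup.mem_subgroupOf.mpr ((hB _).mpr ⟨g.2, h _ g.2⟩))

/-- **`ker (H¹(A, M) → H¹(A ⊓ ker χ, M))` IS ARTINIAN** for every closed `A ≤ Γ_K`, every subgroup `B ≤ A` with `g ∈ B ↔ g ∈ A ∧ χ g = 1`, and every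
discrete `M` with continuous orbit maps that is Artinian as an abelian group (e.g. `p`-primary with `M[p]` finite): §1 with the generator of
`exists_generator_inf_kerSubgroup` (`B` is normal in `A`, being cut out by the character `χ`). [cite: GreenbergLNM1716, §3 Lemma 3.1 (p. 86)]
[cite: Washington1997, §13.1] -/
theorem isArtinian_ker_resOfLe_inf_kerSubgroup (A B : Subgroup (absoluteGaloisGroup K)) (hA : IsClosed (A : Set (absoluteGaloisGroup K)))
    (hB : ∀ g, g ∈ B ↔ g ∈ A ∧ χ g = 1) (hBA : B ≤ A)
    (hcont : ∀ m : M, Continuous fun g : absoluteGaloisGroup K ↦ g • m) [IsArtinian ℤ M] :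
    IsArtinian ℤ (resOfLe M hBA).ker := by
  have hBeq : B.subgroupOf A = χ.kerSubgroup.subgroupOf A := by
    ext g
    rw [Subgroup.mem_subgroupOf, Subgroup.mem_subgroupOf, hB, ZpExtension.mem_kerSubgroup]
    exact ⟨fun h ↦ h.2, fun h ↦ ⟨g.2, h⟩⟩
  haveI : (B.subgroupOf A).Normal := by
    rw [hBeq]
    exact Subgroup.Normal.subgroupOf inferInstance A
  obtain ⟨c, hgen⟩ := exists_generator_inf_kerSubgroup χ A B hA hB
  exact isArtinian_ker_resOfLe hBA c.2 hgen hcont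

/-- **The M-LINE-PIN receptacle.** For a pair of `ℤ_p`-extensions `κ, κ₂`, a place `𝔮` and a discrete Artinian `M` with continuous orbit maps:
`ker (H¹(ker κ ⊓ I_𝔮, M) → H¹(pairKer κ κ₂ ⊓ I_𝔮, M))` — the group receiving the components of the `v̄`-defect of slot-1 control (part 3
`mem_range_lineRes_unr_iff_exists_lift_forall_lt`) — is an Artinian `ℤ`-module, so every quotient of a finite power of it has finite `p`-torsion.
[cite: GreenbergLNM1716, §3 Lemma 3.1 (p. 86)] [cite: GreenbergVatsal2000, §2 pp. 17–21] -/
theorem isArtinian_ker_resOfLe_inertia_pairKer (κ κ₂ : ZpExtension K p) (𝔮 : HeightOneSpectrum (𝓞 K))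
    (hcont : ∀ m : M, Continuous fun g : absoluteGaloisGroup K ↦ g • m) [IsArtinian ℤ M] :
    IsArtinian ℤ (resOfLe M (inf_le_inf_right (inertia 𝔮) (ZpExtension.pairKer_le_left κ κ₂) :
      ZpExtension.pairKer κ κ₂ ⊓ inertia 𝔮 ≤ κ.kerSubgroup ⊓ inertia 𝔮)).ker :=
  isArtinian_ker_resOfLe_inf_kerSubgroup κ₂ (κ.kerSubgroup ⊓ inertia 𝔮) (ZpExtension.pairKer κ κ₂ ⊓ inertia 𝔮)
    (κ.isClosed_kerSubgroup.inter (AnomalousLocalTorsion.isClosed_inertia' 𝔮))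
    (fun g ↦ by
      simp only [Subgroup.mem_inf, ZpExtension.mem_kerSubgroup]
      tauto)
    _ hcont

end Galois

end Summit.BirchSwinnertonDyer.BirchSwinnertonDyer.Theorems.PrintCf2.LinePinDefect

end
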